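import Mathlib.Analysis.InnerProductSpace.Projection.Basic
import Literature.Analysis.InnerProduct.SubspaceLeakage
import HarnessLib

/-!
# The min–max level with APPROXIMATE constraints: a trial vector orthogonal to vectors CLOSE to the top eigenvectors has Rayleigh quotient
# at most `λ_k + (λ₀ − λ_k)·sin²Θ`

Topic `Literature/Analysis/OperatorTheory` (next to `SecondLevelGapDense`, `RitzSubspaceProximity`; uses `InnerProduct/SubspaceLeakage`).  Setting: an
inner product space `E` over `𝕜 = ℝ, ℂ`, a symmetric bounded operator `T`, a complete subspace `V` (think: the span of the top `k` eigenvectors) which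
is `T`-INVARIANT and on which `re⟪Tu, u⟫ ≤ λ₀‖u‖²`, with `re⟪Tw, w⟫ ≤ λ_k‖w‖²` on `Vᗮ`.  The exact min–max step (Reed–Simon IV Thm XIII.1, proof: the
form SPLITS along `V ⊕ Vᗮ` because the cross terms vanish by invariance) gives, for EVERY `ψ`,
  `re⟪Tψ, ψ⟫ ≤ λ_k‖ψ‖² + (λ₀ − λ_k)‖P_Vψ‖²`           (`re_inner_le_of_invariant`),
and the «transfer of orthogonality» `‖P_Vψ‖ ≤ ‖P_V − P_U‖·‖ψ‖` for `ψ ⊥ U` (Golub–Van Loan §2.5.3: `‖P_V − P_U‖ = sin Θ_max(U,V)`; tree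
`SubspaceLeakage.norm_starProjection_le_opNorm_sub_of_mem_orthogonal`) turns it into the APPROXIMATE-CONSTRAINT BOUND
  `ψ ⊥ U ⟹ re⟪Tψ, ψ⟫ ≤ (λ_k + (λ₀ − λ_k)‖P_V − P_U‖²)‖ψ‖²`      (★ `re_inner_le_of_mem_orthogonal_approx`):
constraining by a subspace `U` at angle `Θ` from the true top eigenspace costs only `(λ₀ − λ_k)sin²Θ` — SECOND order in the accuracy of the
approximate eigenvectors.  Without invariance but with `T ≥ 0` the form is still a seminorm-square and one gets the FIRST-order bound
`re⟪Tψ, ψ⟫ ≤ (√λ₀‖P_Vψ‖ + √λ_k‖ψ − P_Vψ‖)²` (`re_inner_le_sq_add_of_nonneg`).  All PROVED; no definitions, no named facts.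

Use (cell `ym-beyond`, route `LuscherReduction`): the «no intruders» halves (`SlabNoIntruder`, `OneSiteAbsUpperInner`) constrain by EXPLICIT lifted /
quasimode states, not by true eigenvectors; this file is the bookkeeping of that replacement (MEMO-RED-slab §3: «norm-accuracy needed of the lifted
states vs true eigenvectors: δ ≲ Λ^{1/2}» is the second-order phenomenon above), and a brick of the level-`k` Courant–Fischer principle over a dense
core (LIT-INDEX §11 D(4)–(5)).

## References
* M. Reed, B. Simon, *Methods of Modern Mathematical Physics IV*, 1978, Thm XIII.1 (min–max principle). [ReedSimonIV1978]
* G. H. Golub, C. F. Van Loan, *Matrix Computations*, 4th ed., 2013, §2.5.3 and §8.1.3 (distance between subspaces; invariant-subspace sensitivity). [GolubVanLoan2013]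
-/

set_option autoImplicit false

open scoped InnerProductSpace
open RCLike

namespace Literature.Analysis.OperatorTheory.ApproximateConstraint

variable {𝕜 : Type*} [RCLike 𝕜] {E : Type*} [NormedAddCommGroup E] [InnerProductSpace 𝕜 E]
variable (V : Submodule 𝕜 E) [V.HasOrthogonalProjection] (T : E →L[𝕜] E)

/-- **Splitting of the form along an invariant subspace** (the step in the proof of the min–max principle): if `T` is symmetric and `TV ⊆ V` then
for `ψ = u + w`, `u = P_Vψ`, `w = ψ − P_Vψ`: `⟪Tψ, ψ⟫ = ⟪Tu, u⟫ + ⟪Tw, w⟫`. [cite: ReedSimonIV1978, Thm XIII.1] -/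
theorem inner_eq_add_of_invariant (hT : ∀ x y : E, ⟪T x, y⟫_𝕜 = ⟪x, T y⟫_𝕜) (hV : ∀ v ∈ V, T v ∈ V) (ψ : E) :
    ⟪T ψ, ψ⟫_𝕜 = ⟪T (V.starProjection ψ), V.starProjection ψ⟫_𝕜 +
      ⟪T (ψ - V.starProjection ψ), ψ - V.starProjection ψ⟫_𝕜 := by
  set u : E := V.starProjection ψ with hu
  set w : E := ψ - V.starProjection ψ with hw
  have huV : u ∈ V := V.starProjection_apply_mem ψ
  have hwV : w ∈ Vᗮ := V.sub_starProjection_mem_orthogonal ψ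
  have hψ : ψ = u + w := by rw [hu, hw]; abel
  have c1 : ⟪T u, w⟫_𝕜 = 0 := V.inner_right_of_mem_orthogonal (hV u huV) hwV
  have c2 : ⟪T w, u⟫_𝕜 = 0 := by rw [hT, V.inner_left_of_mem_orthogonal (hV u huV) hwV]
  conv_lhs => rw [hψ]
  rw [map_add, inner_add_left, inner_add_right, inner_add_right, c1, c2, add_zero, zero_add]

/-- ★ **Exact constraints, invariant form**: `T` symmetric, `V` complete and `T`-invariant, `re⟪Tu, u⟫ ≤ λ₀‖u‖²` on `V`, `re⟪Tw, w⟫ ≤ λ_k‖w‖²` on `Vᗮ`.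
Then for EVERY `ψ`: `re⟪Tψ, ψ⟫ ≤ λ_k‖ψ‖² + (λ₀ − λ_k)‖P_Vψ‖²`. [cite: ReedSimonIV1978, Thm XIII.1] -/
theorem re_inner_le_of_invariant (hT : ∀ x y : E, ⟪T x, y⟫_𝕜 = ⟪x, T y⟫_𝕜) (hV : ∀ v ∈ V, T v ∈ V)
    {lam0 lamk : ℝ} (h0 : ∀ u ∈ V, re ⟪T u, u⟫_𝕜 ≤ lam0 * ‖u‖ ^ 2) (hk : ∀ w ∈ Vᗮ, re ⟪T w, w⟫_𝕜 ≤ lamk * ‖w‖ ^ 2)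
    (ψ : E) :
    re ⟪T ψ, ψ⟫_𝕜 ≤ lamk * ‖ψ‖ ^ 2 + (lam0 - lamk) * ‖V.starProjection ψ‖ ^ 2 := by
  have huV : V.starProjection ψ ∈ V := V.starProjection_apply_mem ψ
  have hwV : ψ - V.starProjection ψ ∈ Vᗮ := V.sub_starProjection_mem_orthogonal ψ
  have hpy : ‖ψ‖ ^ 2 = ‖V.starProjection ψ‖ ^ 2 + ‖ψ - V.starProjection ψ‖ ^ 2 := by
    have horth : ⟪V.starProjection ψ, ψ - V.starProjection ψ⟫_𝕜 = 0 := V.inner_right_of_mem_orthogonal huV hwV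
    have h := norm_add_sq_eq_norm_sq_add_norm_sq_of_inner_eq_zero _ _ horth
    rw [add_sub_cancel] at h
    rw [sq, sq, sq]; exact h
  rw [inner_eq_add_of_invariant V T hT hV ψ, map_add]
  have a := h0 _ huV
  have b := hk _ hwV
  have e : lamk * ‖ψ‖ ^ 2 = lamk * ‖V.starProjection ψ‖ ^ 2 + lamk * ‖ψ - V.starProjection ψ‖ ^ 2 := by
    rw [hpy]; ring
  linarith [a, b, e]

/-- With a LEAKAGE bound `‖P_Vψ‖ ≤ ε‖ψ‖` and `λ_k ≤ λ₀`: `re⟪Tψ, ψ⟫ ≤ (λ_k + (λ₀ − λ_k)ε²)‖ψ‖²`. [cite: ReedSimonIV1978, Thm XIII.1] -/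
theorem re_inner_le_of_invariant_of_leakage (hT : ∀ x y : E, ⟪T x, y⟫_𝕜 = ⟪x, T y⟫_𝕜) (hV : ∀ v ∈ V, T v ∈ V)
    {lam0 lamk : ℝ} (hle : lamk ≤ lam0) (h0 : ∀ u ∈ V, re ⟪T u, u⟫_𝕜 ≤ lam0 * ‖u‖ ^ 2)
    (hk : ∀ w ∈ Vᗮ, re ⟪T w, w⟫_𝕜 ≤ lamk * ‖w‖ ^ 2)
    {ψ : E} {ε : ℝ} (hleak : ‖V.starProjection ψ‖ ≤ ε * ‖ψ‖) :
    re ⟪T ψ, ψ⟫_𝕜 ≤ (lamk + (lam0 - lamk) * ε ^ 2) * ‖ψ‖ ^ 2 := by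
  have h := re_inner_le_of_invariant V T hT hV h0 hk ψ
  have h2 : ‖V.starProjection ψ‖ ^ 2 ≤ (ε * ‖ψ‖) ^ 2 := by
    gcongr
  have h3 : (lam0 - lamk) * ‖V.starProjection ψ‖ ^ 2 ≤ (lam0 - lamk) * (ε * ‖ψ‖) ^ 2 :=
    mul_le_mul_of_nonneg_left h2 (by linarith)
  nlinarith [h, h3]

/-- ★ **APPROXIMATE CONSTRAINTS** (min–max with constraint vectors spanning a subspace `U` CLOSE to the invariant top space `V`): for every
`ψ ⊥ U`, `re⟪Tψ, ψ⟫ ≤ (λ_k + (λ₀ − λ_k)‖P_V − P_U‖²)‖ψ‖²` — the cost of replacing the true eigenvectors by approximate ones is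
`(λ₀ − λ_k)·sin²Θ_max(U, V)`, SECOND order in their accuracy (transfer of orthogonality `‖P_Vψ‖ ≤ ‖P_V − P_U‖‖ψ‖`).
[cite: ReedSimonIV1978, Thm XIII.1] [cite: GolubVanLoan2013, §2.5.3] -/
theorem re_inner_le_of_mem_orthogonal_approx (U : Submodule 𝕜 E) [U.HasOrthogonalProjection]
    (hT : ∀ x y : E, ⟪T x, y⟫_𝕜 = ⟪x, T y⟫_𝕜) (hV : ∀ v ∈ V, T v ∈ V)
    {lam0 lamk : ℝ} (hle : lamk ≤ lam0) (h0 : ∀ u ∈ V, re ⟪T u, u⟫_𝕜 ≤ lam0 * ‖u‖ ^ 2)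
    (hk : ∀ w ∈ Vᗮ, re ⟪T w, w⟫_𝕜 ≤ lamk * ‖w‖ ^ 2) {ψ : E} (hψ : ψ ∈ Uᗮ) :
    re ⟪T ψ, ψ⟫_𝕜 ≤ (lamk + (lam0 - lamk) * ‖V.starProjection - U.starProjection‖ ^ 2) * ‖ψ‖ ^ 2 :=
  re_inner_le_of_invariant_of_leakage V T hT hV hle h0 hk
    (Literature.Analysis.InnerProduct.norm_starProjection_le_opNorm_sub_of_mem_orthogonal U V hψ)

/-- Sup form of the approximate-constraint bound (ready for an inf–sup door): every Rayleigh quotient over `Uᗮ ∖ {0}` is at most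
`λ_k + (λ₀ − λ_k)‖P_V − P_U‖²`. [cite: ReedSimonIV1978, Thm XIII.1] [cite: GolubVanLoan2013, §2.5.3] -/
theorem rayleigh_le_of_mem_orthogonal_approx (U : Submodule 𝕜 E) [U.HasOrthogonalProjection]
    (hT : ∀ x y : E, ⟪T x, y⟫_𝕜 = ⟪x, T y⟫_𝕜) (hV : ∀ v ∈ V, T v ∈ V)
    {lam0 lamk : ℝ} (hle : lamk ≤ lam0) (h0 : ∀ u ∈ V, re ⟪T u, u⟫_𝕜 ≤ lam0 * ‖u‖ ^ 2)
    (hk : ∀ w ∈ Vᗮ, re ⟪T w, w⟫_𝕜 ≤ lamk * ‖w‖ ^ 2) {ψ : E} (hψ : ψ ∈ Uᗮ) (hψ0 : ψ ≠ 0) :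
    re ⟪T ψ, ψ⟫_𝕜 / ‖ψ‖ ^ 2 ≤ lamk + (lam0 - lamk) * ‖V.starProjection - U.starProjection‖ ^ 2 := by
  have hn : 0 < ‖ψ‖ ^ 2 := by positivity
  rw [div_le_iff₀ hn]
  exact re_inner_le_of_mem_orthogonal_approx V T U hT hV hle h0 hk hψ

/-! ## Without invariance: the first-order bound for a nonnegative form -/

/-- **Cauchy–Schwarz for the form of a symmetric nonnegative operator** (real part): `(re⟪Tu, w⟫)² ≤ re⟪Tu, u⟫·re⟪Tw, w⟫`. [folklore] -/
private theorem re_inner_sq_le (hT : ∀ x y : E, ⟪T x, y⟫_𝕜 = ⟪x, T y⟫_𝕜) (hpos : ∀ x, 0 ≤ re ⟪T x, x⟫_𝕜)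
    (u w : E) : (re ⟪T u, w⟫_𝕜) ^ 2 ≤ re ⟪T u, u⟫_𝕜 * re ⟪T w, w⟫_𝕜 := by
  -- `t ↦ re⟪T(u + t w), u + t w⟫ = re⟪Tu,u⟫ + 2t·re⟪Tu,w⟫ + t²·re⟪Tw,w⟫ ≥ 0`
  have hcross : re ⟪T w, u⟫_𝕜 = re ⟪T u, w⟫_𝕜 := by
    rw [hT w u, ← inner_conj_symm, conj_re]
  have hquad : ∀ t : ℝ, 0 ≤ re ⟪T w, w⟫_𝕜 * (t * t) + 2 * re ⟪T u, w⟫_𝕜 * t + re ⟪T u, u⟫_𝕜 := by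
    intro t
    have h := hpos (u + (t : 𝕜) • w)
    have e : re ⟪T (u + (t : 𝕜) • w), u + (t : 𝕜) • w⟫_𝕜 =
        re ⟪T w, w⟫_𝕜 * (t * t) + 2 * re ⟪T u, w⟫_𝕜 * t + re ⟪T u, u⟫_𝕜 := by
      rw [map_add, map_smul, inner_add_left, inner_add_right, inner_add_right, inner_smul_left, inner_smul_right,
        inner_smul_left, inner_smul_right, conj_ofReal]
      simp only [map_add, re_ofReal_mul]
      rw [hcross]
      ring
    rwa [e] at h
  have hd := discrim_le_zero hquad
  rw [discrim] at hd
  nlinarith [hd]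

/-- **First-order bound without invariance**: `T` symmetric with `re⟪Tx, x⟫ ≥ 0`, `re⟪Tu, u⟫ ≤ λ₀‖u‖²` on `V`, `re⟪Tw, w⟫ ≤ λ_k‖w‖²` on `Vᗮ`
(`λ₀, λ_k ≥ 0`).  Then `re⟪Tψ, ψ⟫ ≤ (√λ₀·‖P_Vψ‖ + √λ_k·‖ψ − P_Vψ‖)²` for every `ψ` (the form is the square of a seminorm).
[cite: ReedSimonIV1978, Thm XIII.1] -/
theorem re_inner_le_sq_add_of_nonneg (hT : ∀ x y : E, ⟪T x, y⟫_𝕜 = ⟪x, T y⟫_𝕜) (hpos : ∀ x, 0 ≤ re ⟪T x, x⟫_𝕜)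
    {lam0 lamk : ℝ} (hl0 : 0 ≤ lam0) (hlk : 0 ≤ lamk)
    (h0 : ∀ u ∈ V, re ⟪T u, u⟫_𝕜 ≤ lam0 * ‖u‖ ^ 2) (hk : ∀ w ∈ Vᗮ, re ⟪T w, w⟫_𝕜 ≤ lamk * ‖w‖ ^ 2) (ψ : E) :
    re ⟪T ψ, ψ⟫_𝕜 ≤
      (Real.sqrt lam0 * ‖V.starProjection ψ‖ + Real.sqrt lamk * ‖ψ - V.starProjection ψ‖) ^ 2 := by
  set u : E := V.starProjection ψ with hu
  set w : E := ψ - V.starProjection ψ with hw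
  have huV : u ∈ V := V.starProjection_apply_mem ψ
  have hwV : w ∈ Vᗮ := V.sub_starProjection_mem_orthogonal ψ
  have hψ : ψ = u + w := by rw [hu, hw]; abel
  have hcross : re ⟪T w, u⟫_𝕜 = re ⟪T u, w⟫_𝕜 := by
    rw [hT w u, ← inner_conj_symm, conj_re]
  have hexp : re ⟪T ψ, ψ⟫_𝕜 = re ⟪T u, u⟫_𝕜 + 2 * re ⟪T u, w⟫_𝕜 + re ⟪T w, w⟫_𝕜 := by
    conv_lhs => rw [hψ]
    rw [map_add, inner_add_left, inner_add_right, inner_add_right]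
    simp only [map_add, hcross]
    ring
  have hcs := re_inner_sq_le T hT hpos u w
  have qu := hpos u
  have qw := hpos w
  -- `q(u) ≤ (√λ₀‖u‖)²`, `q(w) ≤ (√λ_k‖w‖)²`
  have hu' : re ⟪T u, u⟫_𝕜 ≤ (Real.sqrt lam0 * ‖u‖) ^ 2 := by
    rw [mul_pow, Real.sq_sqrt hl0]; exact h0 u huV
  have hw' : re ⟪T w, w⟫_𝕜 ≤ (Real.sqrt lamk * ‖w‖) ^ 2 := by
    rw [mul_pow, Real.sq_sqrt hlk]; exact hk w hwV
  have ha : 0 ≤ Real.sqrt lam0 * ‖u‖ := by positivity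
  have hb : 0 ≤ Real.sqrt lamk * ‖w‖ := by positivity
  -- `2 re⟪Tu,w⟫ ≤ 2 √q(u) √q(w) ≤ 2 (√λ₀‖u‖)(√λ_k‖w‖)`
  have hx : re ⟪T u, w⟫_𝕜 ≤ Real.sqrt lam0 * ‖u‖ * (Real.sqrt lamk * ‖w‖) := by
    have h1 : (re ⟪T u, w⟫_𝕜) ^ 2 ≤ (Real.sqrt lam0 * ‖u‖ * (Real.sqrt lamk * ‖w‖)) ^ 2 := by
      rw [mul_pow]
      exact hcs.trans (mul_le_mul hu' hw' qw (by positivity))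
    exact (abs_le_of_sq_le_sq' h1 (by positivity)).2
  rw [hexp]
  nlinarith [hu', hw', hx, ha, hb]

end Literature.Analysis.OperatorTheory.ApproximateConstraint
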